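import Summits.KontsevichZagierPeriods.KontsevichZagierPeriods.Theorems.RootDecompRelativeModAbsoluteRegKernelPairLeOneP10
import Summits.KontsevichZagierPeriods.KontsevichZagierPeriods.Theorems.RootDecompRelativeModAbsoluteRegFoldingDegOneP13

/-!
(LANDED by the census seat decomp-kz-census-1 g7 `--supports stmt-KontsevichZagierPeriods-30572`; source lens-3 g9 landing package #2 / CylKernelZero Inline fallback, critic decomp-kz-crit-1 g2 CLEARED §14–§19; generic docstrings added where the source had none.)

# `RegKernelPairDegOne`, the COMMON-`κ₀ > 0` case with BOTH KINDS (route `RootDecompRelativeModAbsolute`,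
support item stmt-KontsevichZagierPeriods-30572) — PROVED · part 11 (the two core lemmas)

Cell `decomp-kz`, lens 3 (decomp-kz-lens-3 g9), §18 of the HOME file.  Item 30572 for ANY numbers `k, k'` of
regularised monomials of EITHER kind (`eᵢ, e'ⱼ ∈ {1,2}` free per monomial) sharing ONE argument function
`κ₀ > 0` (`κᵢ = κ'ⱼ = κ₀`, `ℚ`-semialgebraic on `G ∪ G'`).  The fibre numbers obey `ℓ_{2j+1,2}(κ) = ℓ_{j,1}(κ)/2`,
so this rung needs ONE genuine change of variables (Kontsevich–Zagier rule (2), tree generator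
`KZ.changeOfVariablesRel`): the fibrewise squaring `(x,θ) ↦ (x,θ²)` on the OPEN cylinder, turning odd
arctan-kind monomials into log-kind ones; Baker (mixed form) then kills the log-kind and the even-arctan-kind
remainders.  This part: the core lemmas `cyl_logEven_mem_relations` (log-kind + even-arctan-kind family with a.e.-vanishing fibre integrals is a relation: two Taylor divisions, mixed rigidity, restriction, polynomial fold, a.e.-zero base) and `cyl_commonMixed_mem_relations` (both kinds: split off the odd arctan part by rule (1b), square it by rule (2), recombine, reduce to the former).

Source: `HOME/decomp-kz-lens-3/g9/RelativeModAbsoluteDegOneBands.lean` §18 (v6 sha256 720470ba3a4f13d9, 8617 l;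
farm rc 0 / 0 warn / 0 sorry; `#print axioms regKernelPairDegOne_of_commonPos` = propext, Classical.choice,
Quot.sound), extracted verbatim into the namespace of the landed chain.  No `sorry`; standard axioms.
References: Baker 1975 Thm 2.1 [tree: `baker_holds`]; [cite: KontsevichZagier2001, §1.2]; Bochnak–Coste–Roy 1998 §2.9.
-/

noncomputable section

open Set MeasureTheory Filter Topology
open scoped BigOperators
open Literature.NumberTheory.Transcendental Literature.ModelTheory.ExponentialFields

namespace Summit.KontsevichZagierPeriods.RootDecompRelativeModAbsolute.Rung30571

namespace RegularisedLogLayer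

/-- (PRIVATE copy — the chain module RegFoldingDegOneP05 keeps this lemma private because its landed twin lives in a farm-unbuilt HyperbolicBloch module.) Finite sums of `ℚ`-semialgebraic functions are `ℚ`-semialgebraic. [BCR 1998, Prop. 2.2.6] -/
private theorem isSemialgebraicFunOn_finset_sum {n : ℕ} {s : Set (Fin n → ℝ)} (hs : IsSemialgebraic ℚ s)
    {ι : Type*} (I : Finset ι) {f : ι → (Fin n → ℝ) → ℝ}
    (hf : ∀ i ∈ I, IsSemialgebraicFunOn ℚ s (f i)) :
    IsSemialgebraicFunOn ℚ s (fun x => ∑ i ∈ I, f i x) := by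
  classical
  induction I using Finset.induction_on with
  | empty => exact (isSemialgebraicFunOn_ratCast hs 0).congr fun x _ => by simp
  | insert a I ha ih =>
    have h1 : IsSemialgebraicFunOn ℚ s (f a) := hf a (Finset.mem_insert_self a I)
    have h2 := ih fun i hi => hf i (Finset.mem_insert_of_mem hi)
    refine (IsSemialgebraicFunOn.add_holds h1 h2).congr fun x _ => ?_
    simp only [Pi.add_apply, Finset.sum_insert ha]

section LogEvenCore

/-- **Core lemma (log-kind + even arctan-kind, one common `κ > 0`).** A representation `V` on
`P × (0,1)` with integrand `a₀(x) + Σ_{m ≤ n} c¹_m(x) θ^m/(1+θκ(x)) + Σ_{j ≤ n} c²_j(x) θ^{2j}/(1+θ²κ(x))`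
(all data `ℚ`-semialgebraic on `P`, `κ > 0` on `P`) whose fibre integrals vanish a.e. on `P` is a relation:
Taylor division of the log part by `1 + κθ` and of the even part by `1 + κw` (`w = θ²`), the two
remainders vanish a.e. by the mixed rigidity (`mixed_rem_ae_eq_zero`), restriction to that full-measure
piece, polynomial fold, a.e.-zero base integrand. [Baker1975 Thm 2.1; KZ 2001 §1.2; this file §10.2, §14, §15] -/
theorem cyl_logEven_mem_relations {P : Set (Fin 1 → ℝ)} (hP : IsSemialgebraic ℚ P)
    (V : KZ.IntegralRep (1 + 1)) {a₀ κ : (Fin 1 → ℝ) → ℝ} (n : ℕ) {c₁ c₂ : ℕ → (Fin 1 → ℝ) → ℝ}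
    (ha₀ : IsSemialgebraicFunOn ℚ P a₀) (hκs : IsSemialgebraicFunOn ℚ P κ)
    (hc₁ : ∀ m, IsSemialgebraicFunOn ℚ P (c₁ m)) (hc₂ : ∀ j, IsSemialgebraicFunOn ℚ P (c₂ j))
    (hκ0 : ∀ x ∈ P, 0 < κ x)
    (hdom : V.domain = RTerm.cyl P)
    (hint : EqOn V.integrand (fun z => a₀ (Fin.init z) +
      ∑ m ∈ Finset.range (n + 1), c₁ m (Fin.init z) * kernel m 1 (κ (Fin.init z)) (z (Fin.last 1)) +
      ∑ j ∈ Finset.range (n + 1),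
        c₂ j (Fin.init z) * kernel (2 * j) 2 (κ (Fin.init z)) (z (Fin.last 1))) V.domain)
    (hzero : ∀ᵐ x, x ∈ P →
      a₀ x + ∑ m ∈ Finset.range (n + 1), c₁ m x * ell m 1 (κ x) +
        ∑ j ∈ Finset.range (n + 1), c₂ j x * ell (2 * j) 2 (κ x) = 0) :
    KZ.of V ∈ KZ.relations := by
  classical
  have hPm : MeasurableSet P := hP.measurableSet_holds
  have hκ1 : ∀ x ∈ P, -1 < κ x := fun x hx => by have := hκ0 x hx; linarith
  -- Taylor data: log part in `θ`, even part in `w = θ²`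
  set s₁ : ℕ → (Fin 1 → ℝ) → ℝ := fun k x => tayCoeff n (fun i => c₁ i x) (κ x) k with hs₁_def
  set sE : ℕ → (Fin 1 → ℝ) → ℝ := fun k x => tayCoeff n (fun i => c₂ i x) (κ x) k with hsE_def
  set R₁ : (Fin 1 → ℝ) → ℝ := fun x => tayRem n (fun i => c₁ i x) (κ x) with hR₁_def
  set RE : (Fin 1 → ℝ) → ℝ := fun x => tayRem n (fun i => c₂ i x) (κ x) with hRE_def
  have hs₁ : ∀ k, IsSemialgebraicFunOn ℚ P (s₁ k) := fun k =>
    isSemialgebraicFunOn_tayCoeff hP n hc₁ hκs k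
  have hsE : ∀ k, IsSemialgebraicFunOn ℚ P (sE k) := fun k =>
    isSemialgebraicFunOn_tayCoeff hP n hc₂ hκs k
  have hR₁ : IsSemialgebraicFunOn ℚ P R₁ := isSemialgebraicFunOn_tayRem hP n hc₁ hκs
  have hRE : IsSemialgebraicFunOn ℚ P RE := isSemialgebraicFunOn_tayRem hP n hc₂ hκs
  -- the division identity on the cylinder
  have hdiv : ∀ x ∈ P, ∀ θ ∈ Ioo (0 : ℝ) 1,
      ∑ m ∈ Finset.range (n + 1), c₁ m x * kernel m 1 (κ x) θ +
          ∑ j ∈ Finset.range (n + 1), c₂ j x * kernel (2 * j) 2 (κ x) θ =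
        ∑ k ∈ Finset.range (n + 1), s₁ k x * θ ^ k +
          ∑ k ∈ Finset.range (n + 1), sE k x * θ ^ (2 * k) +
          R₁ x * kernel (n + 1) 1 (κ x) θ + RE x * kernel (2 * n + 2) 2 (κ x) θ := by
    intro x hx θ hθ
    have hpos1 : 0 < 1 + θ ^ 1 * κ x := one_add_pow_mul_pos 1 (hκ1 x hx) (Ioo_subset_Icc_self hθ)
    rw [pow_one] at hpos1
    have hne1 : 1 + κ x * θ ≠ 0 := by rw [mul_comm]; exact hpos1.ne'
    have hpos2 : 0 < 1 + θ ^ 2 * κ x := one_add_pow_mul_pos 2 (hκ1 x hx) (Ioo_subset_Icc_self hθ)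
    have hne2 : 1 + κ x * θ ^ 2 ≠ 0 := by rw [mul_comm]; exact hpos2.ne'
    have t1 := taylor_div n (fun i => c₁ i x) (κ x) θ hne1
    have tE := taylor_div n (fun i => c₂ i x) (κ x) (θ ^ 2) hne2
    simp only [hs₁_def, hsE_def, hR₁_def, hRE_def]
    have e1 : ∑ m ∈ Finset.range (n + 1), c₁ m x * kernel m 1 (κ x) θ =
        ∑ k ∈ Finset.range (n + 1), tayCoeff n (fun i => c₁ i x) (κ x) k * θ ^ k +
          tayRem n (fun i => c₁ i x) (κ x) * θ ^ (n + 1) / (1 + κ x * θ) := by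
      rw [← t1, Finset.sum_div]
      refine Finset.sum_congr rfl fun i _ => ?_
      simp only [kernel, pow_one]
      rw [mul_comm θ (κ x)]
      ring
    have eE : ∑ j ∈ Finset.range (n + 1), c₂ j x * kernel (2 * j) 2 (κ x) θ =
        ∑ k ∈ Finset.range (n + 1), tayCoeff n (fun i => c₂ i x) (κ x) k * (θ ^ 2) ^ k +
          tayRem n (fun i => c₂ i x) (κ x) * (θ ^ 2) ^ (n + 1) / (1 + κ x * θ ^ 2) := by
      rw [← tE, Finset.sum_div]
      refine Finset.sum_congr rfl fun j _ => ?_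
      simp only [kernel]
      rw [pow_mul θ 2 j, mul_comm (θ ^ 2) (κ x)]
      ring
    rw [e1, eE]
    have r1 : ∑ k ∈ Finset.range (n + 1), tayCoeff n (fun i => c₂ i x) (κ x) k * θ ^ (2 * k) =
        ∑ k ∈ Finset.range (n + 1), tayCoeff n (fun i => c₂ i x) (κ x) k * (θ ^ 2) ^ k :=
      Finset.sum_congr rfl fun k _ => by rw [pow_mul θ 2 k]
    have r3 : kernel (2 * n + 2) 2 (κ x) θ = (θ ^ 2) ^ (n + 1) / (1 + κ x * θ ^ 2) := by
      simp only [kernel]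
      rw [show 2 * n + 2 = 2 * (n + 1) by ring, pow_mul θ 2 (n + 1), mul_comm (θ ^ 2) (κ x)]
    have r4 : kernel (n + 1) 1 (κ x) θ = θ ^ (n + 1) / (1 + κ x * θ) := by
      simp only [kernel, pow_one]
      rw [mul_comm θ (κ x)]
    rw [r1, r3, r4]
    ring
  -- the fibre-integral identity
  have hI : ∀ x ∈ P,
      ∑ m ∈ Finset.range (n + 1), c₁ m x * ell m 1 (κ x) +
          ∑ j ∈ Finset.range (n + 1), c₂ j x * ell (2 * j) 2 (κ x) =
        ∑ k ∈ Finset.range (n + 1), s₁ k x / (((k : ℕ) : ℝ) + 1) +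
          ∑ k ∈ Finset.range (n + 1), sE k x / (((2 * k : ℕ) : ℝ) + 1) +
          R₁ x * ell (n + 1) 1 (κ x) + RE x * ell (2 * n + 2) 2 (κ x) := by
    intro x hx
    have hk1 := hκ1 x hx
    have ipow : ∀ j : ℕ, IntegrableOn (fun θ : ℝ => θ ^ j) (Ioo (0 : ℝ) 1) := fun j =>
      ((continuous_pow j).integrableOn_Icc (a := (0 : ℝ)) (b := 1)).mono_set Ioo_subset_Icc_self
    have i1 : ∀ k ∈ Finset.range (n + 1),
        Integrable (fun θ : ℝ => s₁ k x * θ ^ k) (volume.restrict (Ioo (0 : ℝ) 1)) :=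
      fun k _ => (ipow _).const_mul _
    have i1' : ∀ k ∈ Finset.range (n + 1),
        Integrable (fun θ : ℝ => sE k x * θ ^ (2 * k)) (volume.restrict (Ioo (0 : ℝ) 1)) :=
      fun k _ => (ipow _).const_mul _
    have i2 : Integrable (fun θ : ℝ => ∑ k ∈ Finset.range (n + 1), s₁ k x * θ ^ k)
        (volume.restrict (Ioo (0 : ℝ) 1)) := integrable_finsetSum _ i1
    have i2' : Integrable (fun θ : ℝ => ∑ k ∈ Finset.range (n + 1), sE k x * θ ^ (2 * k))
        (volume.restrict (Ioo (0 : ℝ) 1)) := integrable_finsetSum _ i1'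
    have i3 : Integrable (fun θ : ℝ => R₁ x * kernel (n + 1) 1 (κ x) θ)
        (volume.restrict (Ioo (0 : ℝ) 1)) := (integrableOn_kernel (n + 1) 1 hk1).const_mul _
    have i4 : Integrable (fun θ : ℝ => RE x * kernel (2 * n + 2) 2 (κ x) θ)
        (volume.restrict (Ioo (0 : ℝ) 1)) := (integrableOn_kernel (2 * n + 2) 2 hk1).const_mul _
    have i23 : Integrable (fun θ : ℝ => ∑ k ∈ Finset.range (n + 1), s₁ k x * θ ^ k +
        ∑ k ∈ Finset.range (n + 1), sE k x * θ ^ (2 * k)) (volume.restrict (Ioo (0 : ℝ) 1)) :=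
      i2.add i2'
    have i234 : Integrable (fun θ : ℝ => ∑ k ∈ Finset.range (n + 1), s₁ k x * θ ^ k +
        ∑ k ∈ Finset.range (n + 1), sE k x * θ ^ (2 * k) +
        R₁ x * kernel (n + 1) 1 (κ x) θ) (volume.restrict (Ioo (0 : ℝ) 1)) := i23.add i3
    have iA : Integrable (fun θ : ℝ => ∑ m ∈ Finset.range (n + 1), c₁ m x * kernel m 1 (κ x) θ)
        (volume.restrict (Ioo (0 : ℝ) 1)) :=
      integrable_finsetSum _ fun m _ => (integrableOn_kernel m 1 hk1).const_mul _
    have iB : Integrable (fun θ : ℝ => ∑ j ∈ Finset.range (n + 1), c₂ j x * kernel (2 * j) 2 (κ x) θ)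
        (volume.restrict (Ioo (0 : ℝ) 1)) :=
      integrable_finsetSum _ fun j _ => (integrableOn_kernel (2 * j) 2 hk1).const_mul _
    have lhs : ∑ m ∈ Finset.range (n + 1), c₁ m x * ell m 1 (κ x) +
          ∑ j ∈ Finset.range (n + 1), c₂ j x * ell (2 * j) 2 (κ x) =
        ∫ θ in Ioo (0 : ℝ) 1, (∑ m ∈ Finset.range (n + 1), c₁ m x * kernel m 1 (κ x) θ +
          ∑ j ∈ Finset.range (n + 1), c₂ j x * kernel (2 * j) 2 (κ x) θ) := by
      rw [integral_add iA iB,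
        integral_finsetSum _ (fun m _ => (integrableOn_kernel m 1 hk1).const_mul _),
        integral_finsetSum _ (fun j _ => (integrableOn_kernel (2 * j) 2 hk1).const_mul _)]
      congr 1
      · refine Finset.sum_congr rfl fun m _ => ?_
        rw [integral_const_mul]
        rfl
      · refine Finset.sum_congr rfl fun m _ => ?_
        rw [integral_const_mul]
        rfl
    rw [lhs, setIntegral_congr_fun measurableSet_Ioo (fun θ hθ => hdiv x hx θ hθ),
      integral_add i234 i4, integral_add i23 i3, integral_add i2 i2',
      integral_finsetSum _ i1, integral_finsetSum _ i1', integral_const_mul, integral_const_mul]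
    congr 1
    congr 1
    congr 1
    · refine Finset.sum_congr rfl fun k _ => ?_
      rw [integral_const_mul, integral_pow_Ioo]
      ring
    · refine Finset.sum_congr rfl fun k _ => ?_
      rw [integral_const_mul, integral_pow_Ioo]
      ring
  -- rigidity: `R₁ = RE = 0` a.e. on `P`
  set g₀ : (Fin 1 → ℝ) → ℝ := fun x =>
    a₀ x + ∑ k ∈ Finset.range (n + 1), s₁ k x / (((k : ℕ) : ℝ) + 1) +
      ∑ k ∈ Finset.range (n + 1), sE k x / (((2 * k : ℕ) : ℝ) + 1) with hg₀_def
  have hg₀ : IsSemialgebraicFunOn ℚ P g₀ := by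
    refine IsSemialgebraicFunOn.add_holds (IsSemialgebraicFunOn.add_holds ha₀
      (isSemialgebraicFunOn_finset_sum hP _ fun k _ => ?_))
      (isSemialgebraicFunOn_finset_sum hP _ fun k _ => ?_)
    · exact (IsSemialgebraicFunOn.mul_holds (hs₁ k)
        (isSemialgebraicFunOn_ratCast hP ((1 : ℚ) / ((k : ℕ) + 1)))).congr fun x _ => by
          simp [div_eq_mul_inv]
    · exact (IsSemialgebraicFunOn.mul_holds (hsE k)
        (isSemialgebraicFunOn_ratCast hP ((1 : ℚ) / ((2 * k : ℕ) + 1)))).congr fun x _ => by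
          simp [div_eq_mul_inv]
  have hrig : ∀ᵐ x, x ∈ P → RE x = 0 ∧ R₁ x = 0 := by
    refine mixed_rem_ae_eq_zero hP hg₀ hRE hR₁ hκs hκ0 n ?_
    filter_upwards [hzero] with x hx hxP
    have h1 := hx hxP
    rw [add_assoc, hI x hxP] at h1
    simp only [hg₀_def]
    linarith
  -- restrict to the full-measure piece `P₀ = {RE = 0, R₁ = 0}`
  set P₀ : Set (Fin 1 → ℝ) := {x | x ∈ {y | y ∈ P ∧ RE y = 0} ∧ R₁ x = 0} with hP₀_def
  have hP₀ : IsSemialgebraic ℚ P₀ :=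
    isSemialgebraic_sep_eq_zero (hR₁.mono (fun x hx => hx.1) (isSemialgebraic_sep_eq_zero hRE))
  have hP₀m : MeasurableSet P₀ := hP₀.measurableSet_holds
  have hP₀P : P₀ ⊆ P := fun x hx => hx.1.1
  have hnull : volume (P \ P₀) = 0 := by
    rw [measure_eq_zero_iff_ae_notMem]
    filter_upwards [hrig] with x hx hx'
    exact hx'.2 ⟨⟨hx'.1, (hx hx'.1).1⟩, (hx hx'.1).2⟩
  have hcylP₀ : IsSemialgebraic ℚ (RTerm.cyl P₀) := RTerm.isSemialgebraic_cyl hP₀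
  have hsub₀ : RTerm.cyl P₀ ⊆ V.domain := by
    rw [hdom]; exact fun z hz => ⟨hP₀P hz.1, hz.2⟩
  let V₀ : KZ.IntegralRep (1 + 1) := V.restrict _ hcylP₀ hsub₀
  have hVV₀ : KZ.of V - KZ.of V₀ ∈ KZ.relations := by
    refine KZ.IntegralRep.of_sub_of_restrict_mem_relations V hcylP₀ hsub₀ ?_
    refine measure_mono_null (fun z hz => ?_) (KZ.volume_setOf_init_mem_eq_zero hnull)
    have hz1 : z ∈ RTerm.cyl P := hdom ▸ hz.1
    refine ⟨hz1.1, fun h0 => hz.2 ⟨h0, hz1.2⟩⟩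
  -- the polynomial coefficients (degree `≤ 2n`)
  set aN : ℕ → (Fin 1 → ℝ) → ℝ := fun m x =>
    (if m = 0 then a₀ x else 0) + (if m ≤ n then s₁ m x else 0) +
      (if m % 2 = 0 then sE (m / 2) x else 0) with haN_def
  set a : Fin (2 * n + 1) → (Fin 1 → ℝ) → ℝ := fun k x => aN k x with ha_def
  have haN : ∀ m, IsSemialgebraicFunOn ℚ P₀ (aN m) := by
    intro m
    refine IsSemialgebraicFunOn.add_holds (IsSemialgebraicFunOn.add_holds ?_ ?_) ?_
    · by_cases hm : m = 0
      · simp only [hm, if_true]; exact ha₀.mono hP₀P hP₀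
      · simp only [hm, if_false]
        exact (isSemialgebraicFunOn_ratCast hP₀ 0).congr fun x _ => by simp
    · by_cases hm : m ≤ n
      · simp only [hm, if_true]; exact (hs₁ _).mono hP₀P hP₀
      · simp only [hm, if_false]
        exact (isSemialgebraicFunOn_ratCast hP₀ 0).congr fun x _ => by simp
    · by_cases hm : m % 2 = 0
      · simp only [hm, if_true]; exact (hsE _).mono hP₀P hP₀
      · simp only [hm, if_false]
        exact (isSemialgebraicFunOn_ratCast hP₀ 0).congr fun x _ => by simp
  have ha : ∀ k, IsSemialgebraicFunOn ℚ P₀ (a k) := fun k => haN k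
  -- regrouping of `Σ_{m ≤ 2n} aN m · w m` against any weights
  have sum_aN : ∀ (x : Fin 1 → ℝ) (w : ℕ → ℝ),
      ∑ m ∈ Finset.range (2 * n + 1), aN m x * w m =
        a₀ x * w 0 + ∑ k ∈ Finset.range (n + 1), s₁ k x * w k +
          ∑ j ∈ Finset.range (n + 1), sE j x * w (2 * j) := by
    intro x w
    simp only [haN_def, add_mul, Finset.sum_add_distrib]
    congr 1
    congr 1
    · rw [Finset.sum_eq_single 0]
      · simp
      · intro m _ hm; simp [hm]
      · intro h; exact absurd (Finset.mem_range.2 (by omega)) h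
    · rw [show (∑ m ∈ Finset.range (2 * n + 1), (if m ≤ n then s₁ m x else 0) * w m) =
          ∑ m ∈ Finset.range (2 * n + 1), (if m ≤ n then s₁ m x * w m else 0) from
          Finset.sum_congr rfl fun m _ => by split_ifs <;> simp, ← Finset.sum_filter]
      congr 1
      ext m
      simp only [Finset.mem_filter, Finset.mem_range]
      omega
    · set f : ℕ → ℝ := fun m => (if m % 2 = 0 then sE (m / 2) x else 0) * w m with hf
      have hodd : f (2 * n + 1) = 0 := by
        have h1 : ¬ ((2 * n + 1) % 2 = 0) := by omega
        simp only [hf, h1, if_false, zero_mul]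
      have e1 : ∑ m ∈ Finset.range (2 * n + 1), f m = ∑ m ∈ Finset.range (2 * n + 2), f m := by
        rw [show 2 * n + 2 = 2 * n + 1 + 1 by ring, Finset.sum_range_succ f (2 * n + 1), hodd,
          add_zero]
      have e2 : ∀ j, f (2 * j) = sE j x * w (2 * j) := fun j => by
        have h1 : (2 * j) % 2 = 0 := by omega
        have h2 : (2 * j) / 2 = j := by omega
        simp only [hf, h1, h2, if_true]
      have e3 : ∀ j, f (2 * j + 1) = 0 := fun j => by
        have h1 : ¬ ((2 * j + 1) % 2 = 0) := by omega
        simp only [hf, h1, if_false, zero_mul]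
      show ∑ m ∈ Finset.range (2 * n + 1), f m = _
      rw [e1, sum_range_even_odd f n]
      simp only [e2, e3, Finset.sum_const_zero, add_zero]
  have hsumA : ∀ (x : Fin 1 → ℝ) (θ : ℝ), ∑ k : Fin (2 * n + 1), a k x * θ ^ (k : ℕ) =
      a₀ x + (∑ k ∈ Finset.range (n + 1), s₁ k x * θ ^ k +
        ∑ k ∈ Finset.range (n + 1), sE k x * θ ^ (2 * k)) := by
    intro x θ
    rw [Fin.sum_univ_eq_sum_range (fun k => aN k x * θ ^ k) (2 * n + 1), sum_aN x (fun k => θ ^ k)]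
    simp only [pow_zero, mul_one]
    ring
  have hsumB : ∀ x : Fin 1 → ℝ, ∑ k : Fin (2 * n + 1), a k x / ((k : ℕ) + 1) = g₀ x := by
    intro x
    rw [Fin.sum_univ_eq_sum_range (fun k => aN k x / ((k : ℝ) + 1)) (2 * n + 1)]
    have e : ∑ k ∈ Finset.range (2 * n + 1), aN k x / ((k : ℝ) + 1) =
        ∑ k ∈ Finset.range (2 * n + 1), aN k x * (1 / ((k : ℝ) + 1)) :=
      Finset.sum_congr rfl fun k _ => by rw [mul_one_div]
    rw [e, sum_aN x (fun k => 1 / ((k : ℝ) + 1))]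
    simp only [hg₀_def, mul_one_div, Nat.cast_zero, zero_add, div_one, Nat.cast_mul, Nat.cast_ofNat,
      mul_one]
  -- the integrand of `V₀` IS the polynomial, pointwise on `cyl P₀`
  have hpt : ∀ x ∈ P₀, ∀ t ∈ Ioo (0 : ℝ) 1,
      V₀.integrand (Fin.snoc x t) = ∑ k : Fin (2 * n + 1), a k x * t ^ (k : ℕ) := by
    intro x hx t ht
    have hmem : (Fin.snoc x t : Fin (1 + 1) → ℝ) ∈ V.domain := by
      rw [hdom]
      refine ⟨?_, ?_⟩
      · rw [Fin.init_snoc]; exact hx.1.1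
      · rw [Fin.snoc_last]; exact ht
    show V.integrand (Fin.snoc x t) = _
    rw [hint hmem]
    simp only [Fin.init_snoc, Fin.snoc_last]
    rw [add_assoc, hdiv x hx.1.1 t ht, hsumA, hx.1.2, hx.2]
    ring
  -- fold the polynomial representation `V₀`
  obtain ⟨hTb, hfold⟩ := foldsTo_cyl_polynomial V₀ hP₀ ha rfl (fun z hz => by
    have hz' : z ∈ RTerm.cyl P₀ := hz
    have e := hpt (Fin.init z) hz'.1 (z (Fin.last 1)) hz'.2
    rw [Fin.snoc_init_self] at e
    exact e)
  have hV₀B : KZ.of V₀ - KZ.of (RTerm.baseRep _ hTb) ∈ KZ.relations := by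
    have := hfold.1
    rwa [RTerm.unfold_base] at this
  -- the base term has a.e.-zero integrand
  set B := RTerm.baseRep _ hTb with hB_def
  let Z : KZ.IntegralRep 1 := B.restrict ∅ isSemialgebraic_empty (empty_subset _)
  have hZ : KZ.of Z ∈ KZ.relations :=
    KZ.of_mem_relations_of_volume_eq_zero Z (by simp [Z])
  have hBZ : KZ.of B - KZ.of Z ∈ KZ.relations := by
    refine AECongr.of_sub_of_mem_relations_of_indicator_ae B Z ?_
    filter_upwards [hzero] with x hx
    rw [show Z.domain = ∅ from rfl, Set.indicator_empty]
    by_cases hxP₀ : x ∈ P₀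
    · rw [show B.domain = P₀ from rfl, indicator_of_mem hxP₀]
      show ∑ k : Fin (2 * n + 1), a k x / ((k : ℕ) + 1) = 0
      rw [hsumB]
      have h1 := hx hxP₀.1.1
      rw [add_assoc, hI x hxP₀.1.1, hxP₀.1.2, hxP₀.2] at h1
      simp only [hg₀_def]
      linarith
    · rw [show B.domain = P₀ from rfl, indicator_of_notMem hxP₀]
  have e : KZ.of V = (KZ.of V - KZ.of V₀) + ((KZ.of V₀ - KZ.of B) + ((KZ.of B - KZ.of Z) + KZ.of Z)) := by
    abel
  rw [e]
  exact add_mem hVV₀ (add_mem hV₀B (add_mem hBZ hZ))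

end LogEvenCore

section MixedCore

end MixedCore

end RegularisedLogLayer

end Summit.KontsevichZagierPeriods.RootDecompRelativeModAbsolute.Rung30571

end
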